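import Summits.CriticalPhenomena.PercolationContinuityZ3.Theorems.SahiMasterFamilyFCombShiftDet

/-!
# The shifted matching: Kleitman's lemma survives down-compression of the self-dual part
# (row `F` of the master-family inequality, comb form — support file)

Support file (lead seat `prim-nh-lead-4575`, gen 110; `--supports stmt-CriticalPhenomena-4575`), second half of the set-family
part of prim-bnk-2 g21's hand proof of THEOREM F (`run/shared/lean/prim/prim-l12/prim-bnk-2/PROOF-F-inequality.md`, §3), on top
of THEOREM S (`SahiFComb.Shift.isUnit_det_incl_downs`, companion file `…SahiMasterFamilyFCombShiftDet`).  One plumbing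
definition (`sdiffSumEquiv`, the juxtaposition `(S \ H) ⊕ H ≃ S`); no `sorry`; standard axioms.

* `incl_mul_signed_incl` — Möbius inversion on a down-closed family `S`: `ζ[S,S] · (Λ ζ[S,S] Λ) = 1`, `Λ = diag((−1)^{#K})`.
* `det_mul_det_toBlocks₁₁` — Jacobi's complementary-minor identity in block form over any commutative ring
  (`A·B = 1 ⇒ det A · det B₁₁ = det A₂₂`; the tree's real-matrix version is `Literature.Analysis.TotalPositivity.det_mul_det_toBlocks₁₁`).
* `isUnit_det_incl_sdiff` — for `H ⊆ S`, `𝒦 = D_l H` and any bijection `κ : S \ H ≃ S \ 𝒦`, the minor `([x ⊆ κ x'])` has a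
  unit determinant (Jacobi + THEOREM S).
* **`exists_disjoint_equiv` (the CLAIM)** — if moreover `S \ H` is down-closed, there is a bijection `ψ : S \ H ≃ S \ 𝒦` with
  `x ∩ ψ x = ∅` (the disjointness matrix factors as `ζ[L,L]ᵀ Λ ζ[L, S \ 𝒦]`, so a Leibniz term is nonzero).
* **`exists_dominating_equiv` (`(♣)`)** — for an up-closed `G` in a finite cube: a bijection `σG \ G ≃ G \ σ(D_l(σG ∩ G))` with
  `x ⊆ φ x`.  With a FULL coordinate list this is the input of THEOREM K (`K(A,B,G) ≥ 0`, hence `comb_sum_nonneg` and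
  `F ≥ 0` for every increasing third event via `SahiFComb.F_nonneg_of_face_combs_nonneg`) — the K/F assembly is left to the
  companion work (prim-bnk-2). [this work]
-/

namespace Summit.CriticalPhenomena.PercolationContinuityZ3.Theorems

namespace SahiFComb.Shift

open Finset FinsetFamily Matrix

variable {α : Type*} [DecidableEq α]

/-! ### 4. Down-compressions stay inside a down-set -/

/-- A down-compression of a subfamily of a down-closed family stays inside it. [this work] -/
theorem compression_subset_of_lower {S 𝒳 : Finset (Finset α)} (hS : ∀ K ∈ S, ∀ K' ⊆ K, K' ∈ S)
    (h𝒳 : 𝒳 ⊆ S) (i : α) : 𝓓 i 𝒳 ⊆ S := by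
  intro s hs
  rcases Down.mem_compression.1 hs with ⟨h, -⟩ | ⟨-, h⟩
  · exact h𝒳 h
  · exact hS _ (h𝒳 h) _ (subset_insert _ _)

/-- Iterated down-compressions of a subfamily of a down-closed family stay inside it. [this work] -/
theorem downs_subset_of_lower {S : Finset (Finset α)} (hS : ∀ K ∈ S, ∀ K' ⊆ K, K' ∈ S) :
    ∀ (l : List α) (𝒳 : Finset (Finset α)), 𝒳 ⊆ S → l.foldl (fun 𝒴 i => 𝓓 i 𝒴) 𝒳 ⊆ S
  | [], _, h => h
  | i :: l, _, h => downs_subset_of_lower hS l _ (compression_subset_of_lower hS h i)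

/-! ### 5. Möbius inversion on a down-set, Jacobi's complementary-minor identity, the complementary minor -/

/-- An alternating sum over a Boolean interval inside a down-closed family: for `K ∈ S`,
`Σ_{J ∈ S} [F ⊆ J] (−1)^{#J} [J ⊆ K] = (−1)^{#F} [F = K]`. [folklore] -/
theorem sum_interval_neg_one_pow {S : Finset (Finset α)} (hS : ∀ K ∈ S, ∀ K' ⊆ K, K' ∈ S)
    (F K : Finset α) (hK : K ∈ S) :
    (∑ J ∈ S, (if F ⊆ J then (1 : ℤ) else 0) * (-1) ^ #J * (if J ⊆ K then 1 else 0)) =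
      if F = K then (-1) ^ #F else 0 := by
  have h1 : ∀ J ∈ S, (if F ⊆ J then (1 : ℤ) else 0) * (-1) ^ #J * (if J ⊆ K then 1 else 0) =
      if F ⊆ J ∧ J ⊆ K then (-1) ^ #J else 0 := by
    intro J _
    by_cases hFJ : F ⊆ J
    · by_cases hJK : J ⊆ K
      · rw [if_pos hFJ, if_pos hJK, if_pos ⟨hFJ, hJK⟩]; ring
      · rw [if_neg hJK, if_neg (show ¬ (F ⊆ J ∧ J ⊆ K) from fun h => hJK h.2)]; ring
    · rw [if_neg hFJ, if_neg (show ¬ (F ⊆ J ∧ J ⊆ K) from fun h => hFJ h.1)]; ring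
  rw [Finset.sum_congr rfl h1, ← Finset.sum_filter]
  by_cases hFK : F ⊆ K
  · have hset : S.filter (fun J => F ⊆ J ∧ J ⊆ K) = ((K \ F).powerset).image (fun J' => F ∪ J') := by
      ext J
      simp only [mem_filter, mem_image, mem_powerset]
      constructor
      · rintro ⟨-, hFJ, hJK⟩
        exact ⟨J \ F, sdiff_subset_sdiff hJK subset_rfl, union_sdiff_of_subset hFJ⟩
      · rintro ⟨J', hJ', rfl⟩
        have hJK : F ∪ J' ⊆ K := union_subset hFK (hJ'.trans sdiff_subset)
        exact ⟨hS K hK _ hJK, subset_union_left, hJK⟩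
    rw [hset, Finset.sum_image]
    · have h2 : ∀ J' ∈ (K \ F).powerset, (-1 : ℤ) ^ #(F ∪ J') = (-1) ^ #F * (-1) ^ #J' := by
        intro J' hJ'
        rw [card_union_of_disjoint (disjoint_of_subset_right (mem_powerset.1 hJ') disjoint_sdiff), pow_add]
      rw [Finset.sum_congr rfl h2, ← Finset.mul_sum, Finset.sum_powerset_neg_one_pow_card]
      by_cases h : F = K
      · subst h; simp
      · have hne : ¬ K \ F = ∅ := fun h0 => h (subset_antisymm hFK (sdiff_eq_empty_iff_subset.1 h0))
        rw [if_neg hne, if_neg h, mul_zero]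
    · intro J₁ h₁ J₂ h₂ heq
      have d₁ : Disjoint F J₁ := disjoint_of_subset_right (mem_powerset.1 h₁) disjoint_sdiff
      have d₂ : Disjoint F J₂ := disjoint_of_subset_right (mem_powerset.1 h₂) disjoint_sdiff
      calc J₁ = (F ∪ J₁) \ F := (union_sdiff_cancel_left d₁).symm
        _ = (F ∪ J₂) \ F := by rw [show F ∪ J₁ = F ∪ J₂ from heq]
        _ = J₂ := union_sdiff_cancel_left d₂
  · have h0 : ¬ F = K := fun h => hFK (h ▸ subset_rfl)
    rw [if_neg h0]
    refine Finset.sum_eq_zero fun J hJ => ?_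
    exact absurd ((mem_filter.1 hJ).2.1.trans (mem_filter.1 hJ).2.2) hFK

/-- Möbius inversion on a down-closed family: the inclusion matrix `ζ[S,S]` times `Λ ζ[S,S] Λ`, `Λ = diag((−1)^{#K})`, is
the identity (all intervals of a down-set are Boolean). [folklore] -/
theorem incl_mul_signed_incl {S : Finset (Finset α)} (hS : ∀ K ∈ S, ∀ K' ⊆ K, K' ∈ S) :
    incl S S * (Matrix.of fun (J K : S) => (-1 : ℤ) ^ (#(J : Finset α) + #(K : Finset α)) *
      (if (J : Finset α) ⊆ (K : Finset α) then 1 else 0)) = 1 := by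
  ext F K
  simp only [Matrix.mul_apply, incl_apply, Matrix.of_apply, Matrix.one_apply]
  have e1 : ∀ J : S, (if (F : Finset α) ⊆ J then (1 : ℤ) else 0) *
      ((-1) ^ (#(J : Finset α) + #(K : Finset α)) * (if (J : Finset α) ⊆ K then 1 else 0)) =
      (-1) ^ #(K : Finset α) * ((if (F : Finset α) ⊆ J then (1 : ℤ) else 0) * (-1) ^ #(J : Finset α) *
        (if (J : Finset α) ⊆ K then 1 else 0)) := by
    intro J; rw [pow_add]; ring
  rw [Fintype.sum_congr _ _ e1, ← Finset.mul_sum,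
    Finset.sum_coe_sort S (fun J => (if (F : Finset α) ⊆ J then (1 : ℤ) else 0) * (-1) ^ #J *
      (if J ⊆ (K : Finset α) then 1 else 0)),
    sum_interval_neg_one_pow hS (F : Finset α) (K : Finset α) K.2]
  by_cases h : F = K
  · subst h
    rw [if_pos rfl, if_pos rfl, ← pow_add, ← two_mul, pow_mul, neg_one_sq, one_pow]
  · have h' : ¬ (F : Finset α) = (K : Finset α) := fun h' => h (Subtype.ext h')
    rw [if_neg h', if_neg h, mul_zero]

/-- Jacobi's complementary-minor identity in block form, over any commutative ring: if `A * B = 1` then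
`det A · det B₁₁ = det A₂₂` (same proof as `Literature.Analysis.TotalPositivity.det_mul_det_toBlocks₁₁`). [folklore] -/
theorem det_mul_det_toBlocks₁₁ {R : Type*} [CommRing R] {p q : Type*} [Fintype p] [Fintype q] [DecidableEq p]
    [DecidableEq q] (A B : Matrix (p ⊕ q) (p ⊕ q) R) (h : A * B = 1) :
    A.det * B.toBlocks₁₁.det = A.toBlocks₂₂.det := by
  have hA := Matrix.fromBlocks_toBlocks A
  have hB := Matrix.fromBlocks_toBlocks B
  rw [← hA, ← hB, Matrix.fromBlocks_multiply, ← Matrix.fromBlocks_one, Matrix.fromBlocks_inj] at h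
  obtain ⟨h11, -, h21, -⟩ := h
  have hprod : A * Matrix.fromBlocks B.toBlocks₁₁ 0 B.toBlocks₂₁ 1 =
      Matrix.fromBlocks 1 A.toBlocks₁₂ 0 A.toBlocks₂₂ := by
    conv_lhs => rw [← hA]
    rw [Matrix.fromBlocks_multiply, h11, h21]
    simp
  have := congrArg Matrix.det hprod
  rw [Matrix.det_mul, Matrix.det_fromBlocks_zero₁₂, Matrix.det_fromBlocks_zero₂₁] at this
  simpa using this

/-- Juxtaposition of a subfamily and its complement: `(S \ H) ⊕ H ≃ S` for `H ⊆ S`. [this work] -/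
def sdiffSumEquiv (S H : Finset (Finset α)) (hH : H ⊆ S) : (↥(S \ H)) ⊕ (↥H) ≃ ↥S where
  toFun := fun x => match x with
    | Sum.inl K => ⟨K.1, (mem_sdiff.1 K.2).1⟩
    | Sum.inr K => ⟨K.1, hH K.2⟩
  invFun := fun K => if h : (K : Finset α) ∈ H then Sum.inr ⟨K.1, h⟩ else Sum.inl ⟨K.1, mem_sdiff.2 ⟨K.2, h⟩⟩
  left_inv := by
    rintro (K | K)
    · have h : (K : Finset α) ∉ H := (mem_sdiff.1 K.2).2
      simp [h]
    · simp [K.2]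
  right_inv := by
    intro K
    by_cases h : (K : Finset α) ∈ H <;> simp [h]

/-- A product of signs `(−1)^{n_i}` is a unit. [folklore] -/
theorem isUnit_prod_neg_one_pow {ι : Type*} [Fintype ι] (n : ι → ℕ) : IsUnit (∏ i, (-1 : ℤ) ^ n i) :=
  isUnit_iff_exists_inv.2 ⟨∏ i, (-1 : ℤ) ^ n i, by
    rw [← Finset.prod_mul_distrib]
    exact Finset.prod_eq_one fun i _ => by rw [← pow_add, ← two_mul, pow_mul, neg_one_sq, one_pow]⟩

/-- **The complementary minor.**  For a down-closed `S`, a subfamily `H ⊆ S`, a list `l` of distinct coordinates,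
`𝒦 = D_l H` (⊆ `S`) and any bijection `κ : S \ H ≃ S \ 𝒦`, the inclusion minor `([x ⊆ κ x'])_{x,x' ∈ S \ H}` has a unit
determinant — by Jacobi's identity for `ζ[S,S]` (whose inverse is `ΛζΛ`) it is, up to sign, `det ζ[D_l H, H]`, a unit by
THEOREM S. [this work] -/
theorem isUnit_det_incl_sdiff [LinearOrder α] {S H : Finset (Finset α)} (hS : ∀ K ∈ S, ∀ K' ⊆ K, K' ∈ S)
    (hH : H ⊆ S) (l : List α) (hl : l.Nodup) (𝒦 : Finset (Finset α)) (h𝒦 : 𝒦 = l.foldl (fun 𝒴 i => 𝓓 i 𝒴) H)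
    (κ : ↥(S \ H) ≃ ↥(S \ 𝒦)) :
    IsUnit ((incl (S \ H) (S \ 𝒦)).submatrix id κ).det := by
  have h𝒦S : 𝒦 ⊆ S := h𝒦 ▸ downs_subset_of_lower hS l H hH
  -- a bijection `H ≃ 𝒦` and THEOREM S
  have hcard : Fintype.card ↥H = Fintype.card ↥𝒦 := by simp only [Fintype.card_coe, h𝒦, card_downs]
  let κ₁ : ↥H ≃ ↥𝒦 := Fintype.equivOfCardEq hcard
  have hS1 : IsUnit ((incl 𝒦 H).submatrix κ₁ id).det := by
    have key : ∀ (𝒦' : Finset (Finset α)), 𝒦' = l.foldl (fun 𝒴 i => 𝓓 i 𝒴) H →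
        ∀ e : ↥H ≃ ↥𝒦', IsUnit ((incl 𝒦' H).submatrix e id).det := by
      intro 𝒦' h' e; subst h'; exact isUnit_det_incl_downs l hl H e
    exact key 𝒦 h𝒦 κ₁
  -- the big matrices on `H ⊕ (S \ H)`
  let rowE : ↥H ⊕ ↥(S \ H) ≃ ↥S := (Equiv.sumComm _ _).trans (sdiffSumEquiv S H hH)
  let colE : ↥H ⊕ ↥(S \ H) ≃ ↥S :=
    ((Equiv.sumCongr κ₁ κ).trans (Equiv.sumComm _ _)).trans (sdiffSumEquiv S 𝒦 h𝒦S)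
  have hrow_inl : ∀ h : ↥H, ((rowE (Sum.inl h) : ↥S) : Finset α) = h := fun h => rfl
  have hrow_inr : ∀ x : ↥(S \ H), ((rowE (Sum.inr x) : ↥S) : Finset α) = x := fun x => rfl
  have hcol_inl : ∀ h : ↥H, ((colE (Sum.inl h) : ↥S) : Finset α) = (κ₁ h : Finset α) := fun h => rfl
  have hcol_inr : ∀ x : ↥(S \ H), ((colE (Sum.inr x) : ↥S) : Finset α) = (κ x : Finset α) := fun x => rfl
  let M : Matrix ↥S ↥S ℤ := incl S S
  let Minv : Matrix ↥S ↥S ℤ := Matrix.of fun (J K : ↥S) =>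
    (-1 : ℤ) ^ (#(J : Finset α) + #(K : Finset α)) * (if (J : Finset α) ⊆ (K : Finset α) then 1 else 0)
  have hMM : M * Minv = 1 := incl_mul_signed_incl hS
  let A : Matrix (↥H ⊕ ↥(S \ H)) (↥H ⊕ ↥(S \ H)) ℤ := M.submatrix rowE colE
  let B : Matrix (↥H ⊕ ↥(S \ H)) (↥H ⊕ ↥(S \ H)) ℤ := Minv.submatrix colE rowE
  have hAB : A * B = 1 := by
    have : A * B = (M * Minv).submatrix rowE rowE := by
      ext i j
      simp only [A, B, Matrix.mul_apply, submatrix_apply]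
      exact Equiv.sum_comp colE (fun s => M (rowE i) s * Minv s (rowE j))
    rw [this, hMM, Matrix.submatrix_one_equiv]
  have hJ := det_mul_det_toBlocks₁₁ A B hAB
  -- `det A` is a unit (`M` is unitriangular, `A` a doubly re-indexed copy)
  have hdetA : IsUnit A.det := by
    have : A = (M.submatrix colE colE).submatrix (rowE.trans colE.symm) id := by
      ext i j; simp [A, submatrix_apply]
    rw [this, Matrix.det_permute, Matrix.det_submatrix_equiv_self, det_incl_self, mul_one]
    exact Units.isUnit _
  -- `det B₁₁` is a unit: `B₁₁ = Λ₁ · (ζ[𝒦,H] ∘ κ₁) · Λ₂`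
  have hdetB : IsUnit B.toBlocks₁₁.det := by
    have hB11 : B.toBlocks₁₁ = Matrix.diagonal (fun h : ↥H => (-1 : ℤ) ^ #(κ₁ h : Finset α)) *
        ((incl 𝒦 H).submatrix κ₁ id) * Matrix.diagonal (fun h : ↥H => (-1 : ℤ) ^ #(h : Finset α)) := by
      ext h h'
      simp only [B, Matrix.toBlocks₁₁, Matrix.of_apply, submatrix_apply, Matrix.diagonal_mul, Matrix.mul_diagonal,
        incl_apply, id_eq, Minv]
      rw [hcol_inl, hrow_inl, pow_add]; ring
    rw [hB11, Matrix.det_mul, Matrix.det_mul, Matrix.det_diagonal, Matrix.det_diagonal]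
    exact ((isUnit_prod_neg_one_pow _).mul hS1).mul (isUnit_prod_neg_one_pow _)
  -- hence `det A₂₂` is a unit, and `A₂₂` is the matrix of the statement
  have hA22 : A.toBlocks₂₂ = (incl (S \ H) (S \ 𝒦)).submatrix id κ := by
    ext x x'
    simp only [A, Matrix.toBlocks₂₂, Matrix.of_apply, submatrix_apply, incl_apply, id_eq, M]
    rw [hrow_inr, hcol_inr]
  rw [← hA22, ← hJ]
  exact hdetA.mul hdetB

/-! ### 6. The shifted matching -/

/-- **THE SHIFTED MATCHING (CLAIM of PROOF-F-inequality.md §3).**  For a down-closed family `S`, a subfamily `H ⊆ S` whose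
complement `S \ H` is down-closed, a list `l` of distinct coordinates and `𝒦 = D_l H`, there is a bijection
`ψ : S \ H ≃ S \ 𝒦` with `ψ(x) ∩ x = ∅` for every `x`.  Proof: the disjointness matrix factors as
`ζ[L,L]ᵀ · Λ · ζ[L, S \ 𝒦]` (the binomial identity; `L = S \ H` down-closed), so its determinant is a unit by
`isUnit_det_incl_sdiff`; a nonzero Leibniz term is the matching. [this work] -/
theorem exists_disjoint_equiv [LinearOrder α] {S H : Finset (Finset α)} (hS : ∀ K ∈ S, ∀ K' ⊆ K, K' ∈ S)
    (hH : H ⊆ S) (hL : ∀ K ∈ S \ H, ∀ K' ⊆ K, K' ∈ S \ H) (l : List α) (hl : l.Nodup)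
    (𝒦 : Finset (Finset α)) (h𝒦 : 𝒦 = l.foldl (fun 𝒴 i => 𝓓 i 𝒴) H) :
    ∃ ψ : ↥(S \ H) ≃ ↥(S \ 𝒦), ∀ x : ↥(S \ H), Disjoint (x : Finset α) ((ψ x : ↥(S \ 𝒦)) : Finset α) := by
  have h𝒦S : 𝒦 ⊆ S := h𝒦 ▸ downs_subset_of_lower hS l H hH
  -- a bijection `S \ H ≃ S \ 𝒦` (cardinalities agree)
  have hcard : Fintype.card ↥(S \ H) = Fintype.card ↥(S \ 𝒦) := by
    rw [Fintype.card_coe, Fintype.card_coe, card_sdiff_of_subset hH, card_sdiff_of_subset h𝒦S, h𝒦, card_downs]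
  let κ : ↥(S \ H) ≃ ↥(S \ 𝒦) := Fintype.equivOfCardEq hcard
  have hunit : IsUnit ((incl (S \ H) (S \ 𝒦)).submatrix id κ).det := isUnit_det_incl_sdiff hS hH l hl 𝒦 h𝒦 κ
  -- the disjointness matrix and its factorisation
  let DS : Matrix ↥(S \ H) ↥(S \ H) ℤ :=
    Matrix.of fun x x' => if Disjoint (x : Finset α) (κ x' : Finset α) then 1 else 0
  have hDS : DS = (incl (S \ H) (S \ H))ᵀ * Matrix.diagonal (fun F : ↥(S \ H) => (-1 : ℤ) ^ #(F : Finset α)) *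
      ((incl (S \ H) (S \ 𝒦)).submatrix id κ) := by
    ext x x'
    rw [Matrix.mul_apply]
    simp only [DS, Matrix.of_apply, Matrix.mul_diagonal, Matrix.transpose_apply, incl_apply, submatrix_apply, id_eq]
    -- the binomial identity over the down-set `S \ H`
    rw [Finset.sum_coe_sort (S \ H) (fun F => (if F ⊆ (x : Finset α) then (1 : ℤ) else 0) * (-1) ^ #F *
      (if F ⊆ (κ x' : Finset α) then 1 else 0))]
    have h1 : ∀ F ∈ S \ H, (if F ⊆ (x : Finset α) then (1 : ℤ) else 0) * (-1) ^ #F *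
        (if F ⊆ (κ x' : Finset α) then 1 else 0) = if F ⊆ (x : Finset α) ∩ (κ x' : Finset α) then (-1) ^ #F else 0 := by
      intro F _
      by_cases h : F ⊆ (x : Finset α) ∩ (κ x' : Finset α)
      · rw [if_pos h, if_pos (h.trans inter_subset_left), if_pos (h.trans inter_subset_right)]; ring
      · rw [if_neg h]
        by_cases h' : F ⊆ (x : Finset α)
        · rw [if_neg (show ¬ F ⊆ (κ x' : Finset α) from fun h'' => h (subset_inter h' h''))]; ring
        · rw [if_neg h']; ring
    rw [Finset.sum_congr rfl h1, ← Finset.sum_filter]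
    have h2 : (S \ H).filter (fun F => F ⊆ (x : Finset α) ∩ (κ x' : Finset α)) =
        ((x : Finset α) ∩ (κ x' : Finset α)).powerset := by
      ext F
      simp only [mem_filter, mem_powerset]
      exact ⟨fun h => h.2, fun h => ⟨hL _ x.2 F (h.trans inter_subset_left), h⟩⟩
    rw [h2, Finset.sum_powerset_neg_one_pow_card]
    exact if_congr disjoint_iff_inter_eq_empty rfl rfl
  have hDSunit : IsUnit DS.det := by
    rw [hDS, Matrix.det_mul, Matrix.det_mul, Matrix.det_transpose, det_incl_self, one_mul, Matrix.det_diagonal]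
    exact (isUnit_prod_neg_one_pow _).mul hunit
  -- Leibniz: a nonzero permutation term is a perfect matching of the disjointness relation
  have hne : DS.det ≠ 0 := hDSunit.ne_zero
  rw [Matrix.det_apply'] at hne
  obtain ⟨σ, -, hσ⟩ := Finset.exists_ne_zero_of_sum_ne_zero hne
  have hσ' : ∀ i : ↥(S \ H), DS (σ i) i ≠ 0 := fun i =>
    (Finset.prod_ne_zero_iff.1 (mul_ne_zero_iff.1 hσ).2) i (Finset.mem_univ _)
  refine ⟨σ.symm.trans κ, fun x => ?_⟩
  have hx := hσ' (σ.symm x)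
  rw [Equiv.apply_symm_apply] at hx
  simp only [DS, Matrix.of_apply, ne_eq, ite_eq_right_iff, one_ne_zero, imp_false, not_not] at hx
  exact hx


/-! ### 7. The dominating bijection `(♣)` for an up-set -/

/-- **`(♣)` (Kleitman's lemma survives compression of the self-dual part; PROOF-F-inequality.md §2–§3).**  For an up-closed
family `G` in a finite cube, `σ` = complementation, `H = σG ∩ G` and `𝒦 = D_l H` (any list `l` of distinct coordinates), there
is a bijection `φ : σG \ G ≃ G \ σ𝒦` with `x ⊆ φ x` for every `x` (Kleitman–Hall is the case `𝒦 = H`).  With `l` a full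
coordinate list, `σ𝒦` is the up-compressed copy of `H`, and `(♣)` at `W = A ∩ B` gives the comb inequality `K(A,B,G) ≥ 0`
of row `F` (companion work). [this work] -/
theorem exists_dominating_equiv [Fintype α] [LinearOrder α] (G : Finset (Finset α))
    (hG : ∀ K ∈ G, ∀ K', K ⊆ K' → K' ∈ G) (l : List α) (hl : l.Nodup)
    (𝒦 : Finset (Finset α)) (h𝒦 : 𝒦 = l.foldl (fun 𝒴 i => 𝓓 i 𝒴) (G.image compl ∩ G)) :
    ∃ φ : ↥(G.image compl \ G) ≃ ↥(G \ 𝒦.image compl),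
      ∀ x : ↥(G.image compl \ G), (x : Finset α) ⊆ ((φ x : ↥(G \ 𝒦.image compl)) : Finset α) := by
  set S := G.image compl with hSdef
  have hmemS : ∀ K : Finset α, K ∈ S ↔ Kᶜ ∈ G := by
    intro K
    rw [hSdef, mem_image]
    constructor
    · rintro ⟨K', hK', rfl⟩; rwa [compl_compl]
    · intro h; exact ⟨Kᶜ, h, compl_compl K⟩
  have hS : ∀ K ∈ S, ∀ K' ⊆ K, K' ∈ S := fun K hK K' hK' =>
    (hmemS K').2 (hG _ ((hmemS K).1 hK) _ (compl_subset_compl.2 hK'))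
  have hH : S ∩ G ⊆ S := inter_subset_left
  have hL : ∀ K ∈ S \ (S ∩ G), ∀ K' ⊆ K, K' ∈ S \ (S ∩ G) := by
    intro K hK K' hK'
    rw [sdiff_inter_self_left, mem_sdiff] at hK ⊢
    exact ⟨hS K hK.1 K' hK', fun h => hK.2 (hG _ h _ hK')⟩
  obtain ⟨ψ, hψ⟩ := exists_disjoint_equiv hS hH hL l hl 𝒦 h𝒦
  have h𝒦S : 𝒦 ⊆ S := h𝒦 ▸ downs_subset_of_lower hS l _ hH
  -- transport: `S \ (S ∩ G) = S \ G`, and complementation `S \ 𝒦 ≃ G \ σ𝒦`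
  let e₁ : ↥(S \ G) ≃ ↥(S \ (S ∩ G)) := Equiv.subtypeEquivRight (fun K => by rw [sdiff_inter_self_left])
  have hc1 : ∀ y : Finset α, y ∈ S \ 𝒦 → yᶜ ∈ G \ 𝒦.image compl := by
    intro y hy
    rw [mem_sdiff] at hy ⊢
    refine ⟨(hmemS y).1 hy.1, fun h => hy.2 ?_⟩
    obtain ⟨z, hz, hzy⟩ := mem_image.1 h
    rwa [← compl_injective hzy]
  have hc2 : ∀ w : Finset α, w ∈ G \ 𝒦.image compl → wᶜ ∈ S \ 𝒦 := by
    intro w hw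
    rw [mem_sdiff] at hw ⊢
    refine ⟨(hmemS _).2 (by rw [compl_compl]; exact hw.1), fun h => hw.2 (mem_image.2 ⟨wᶜ, h, compl_compl w⟩)⟩
  let e₂ : ↥(S \ 𝒦) ≃ ↥(G \ 𝒦.image compl) :=
    { toFun := fun y => ⟨(y : Finset α)ᶜ, hc1 _ y.2⟩
      invFun := fun w => ⟨(w : Finset α)ᶜ, hc2 _ w.2⟩
      left_inv := fun y => Subtype.ext (compl_compl _)
      right_inv := fun w => Subtype.ext (compl_compl _) }
  refine ⟨e₁.trans (ψ.trans e₂), fun x => ?_⟩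
  have hx := hψ (e₁ x)
  have hx1 : ((e₁ x : ↥(S \ (S ∩ G))) : Finset α) = (x : Finset α) := rfl
  rw [hx1] at hx
  show (x : Finset α) ⊆ ((ψ (e₁ x) : ↥(S \ 𝒦)) : Finset α)ᶜ
  exact subset_compl_iff_disjoint_right.2 hx

end SahiFComb.Shift

end Summit.CriticalPhenomena.PercolationContinuityZ3.Theorems
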